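import Summits.AtomisticToContinuum.HydrodynamicLimit.Theorems.JParityClosureParityBandClosureStressIsotropyOfWindowCovarianceH
import HarnessLib

/-!
# Window-to-cone step of `ParityBandClosure` — helper J: the deviator term over all windows

Support file for the stub `stub_stressIsotropyOfWindowCovariance` of the line `transfer-weighted-parity-chain`
(skeleton v4) of the crux `JParityClosure.ParityBandClosure` (stmt-AtomisticToContinuum-17608).

WHAT.  The functional of `WindowCovarianceIsotropy` seen from the window-to-cone step:

* §1 joint measurability in the window `(t₀, x)` of the window covariance `C_w`, of its deviator `dev` and of the
  weighted deviator `g(σ³ρ_w) dev` (helper H's Fubini measurability of the window fields; `g` continuous), and of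
  the windowed increments `Δm`, `Δρ`;
* §2 `lintegral_devTerm_le` — with `|g| = g₊ + g₋` (`g₊ = max(g, 0)`, `g₋ = max(−g, 0)`, both continuous, nonnegative
  and bounded by the bound of `g`), the deviator term of the one-window estimate integrates over the windows of
  `I ⊆ [0, τ]` to at most `A (D₊ + D₋)`, `D± = ∫_{[0,τ]} ∫ₓ g±(σ³ρ_w) dev` the functionals of `WindowCovarianceIsotropy`
  for the two signed parts (genuine double integrals by helper H: bounded nonnegative measurable integrands).

REFERENCES.  Measure-theoretic glue; helper H of this stub.
-/

noncomputable section

namespace Summit.AtomisticToContinuum.HydrodynamicLimit.Theorems.ParityBandClosureWindowToCone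

open scoped BigOperators Topology Classical MeasureTheory ENNReal InnerProductSpace
open Filter Set MeasureTheory Function
open Literature.MathematicalPhysics.KineticTheory
open Literature.Analysis.FluidPDE
open Literature.Analysis.FunctionSpaces
open Summit.AtomisticToContinuum.HydrodynamicLimit.Theorems.LocalSecondLawNegative
open Summit.AtomisticToContinuum.HydrodynamicLimit.Theorems.LocalSecondLawLedger
open Summit.AtomisticToContinuum.HydrodynamicLimit.Theorems.ChaosClosesEulerReduction
open Summit.AtomisticToContinuum.HydrodynamicLimit.Theorems.ChaosClosesEulerStressIsotropy
open Summit.AtomisticToContinuum.HydrodynamicLimit.Theorems.ChaosClosesEulerWindowedInvariance (tent_nonneg_le cone_nonneg_le)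

variable {N : ℕ}

/-! ## §1 Measurability of the window covariance and its deviator in the window -/

section Orbit

variable {γ : ℝ → Phase N} (hγ : Measurable γ) (r τ : ℝ)
include hγ

/-- The window covariance entry `C_w,jk(t₀, x)` is measurable in the window. [folklore] -/
theorem measurable_Cw (j k : Fin 3) :
    Measurable fun p : ℝ × T3 =>
      (∫ s in Icc 0 τ, (r ^ 2)⁻¹ * max (1 - |s - p.1| / r ^ 2) 0 * MpsiC r (γ s) p.2 (fun v => v j * v k)) -
        (∫ s in Icc 0 τ, (r ^ 2)⁻¹ * max (1 - |s - p.1| / r ^ 2) 0 * MpsiC r (γ s) p.2 (fun v => v j)) *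
        (∫ s in Icc 0 τ, (r ^ 2)⁻¹ * max (1 - |s - p.1| / r ^ 2) 0 * MpsiC r (γ s) p.2 (fun v => v k)) /
        (∫ s in Icc 0 τ, (r ^ 2)⁻¹ * max (1 - |s - p.1| / r ^ 2) 0 * rhoC r (γ s) p.2) :=
  (measurable_MpsiCW hγ r τ (by fun_prop)).sub (((measurable_MpsiCW hγ r τ (by fun_prop)).mul
    (measurable_MpsiCW hγ r τ (by fun_prop))).div (measurable_rhoW hγ r τ))

/-- **The window deviator `dev(t₀, x)` is measurable in the window.** [folklore] -/
theorem measurable_dev :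
    Measurable fun p : ℝ × T3 => ∑ j : Fin 3, ∑ k : Fin 3,
      |((∫ s in Icc 0 τ, (r ^ 2)⁻¹ * max (1 - |s - p.1| / r ^ 2) 0 * MpsiC r (γ s) p.2 (fun v => v j * v k)) -
        (∫ s in Icc 0 τ, (r ^ 2)⁻¹ * max (1 - |s - p.1| / r ^ 2) 0 * MpsiC r (γ s) p.2 (fun v => v j)) *
        (∫ s in Icc 0 τ, (r ^ 2)⁻¹ * max (1 - |s - p.1| / r ^ 2) 0 * MpsiC r (γ s) p.2 (fun v => v k)) /
        (∫ s in Icc 0 τ, (r ^ 2)⁻¹ * max (1 - |s - p.1| / r ^ 2) 0 * rhoC r (γ s) p.2)) -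
      if j = k then (∑ l, ((∫ s in Icc 0 τ, (r ^ 2)⁻¹ * max (1 - |s - p.1| / r ^ 2) 0 * MpsiC r (γ s) p.2 (fun v => v l * v l)) -
        (∫ s in Icc 0 τ, (r ^ 2)⁻¹ * max (1 - |s - p.1| / r ^ 2) 0 * MpsiC r (γ s) p.2 (fun v => v l)) *
        (∫ s in Icc 0 τ, (r ^ 2)⁻¹ * max (1 - |s - p.1| / r ^ 2) 0 * MpsiC r (γ s) p.2 (fun v => v l)) /
        (∫ s in Icc 0 τ, (r ^ 2)⁻¹ * max (1 - |s - p.1| / r ^ 2) 0 * rhoC r (γ s) p.2))) / 3 else 0| := by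
  have hC := measurable_Cw hγ r τ
  have htr : Measurable fun p : ℝ × T3 => (∑ l : Fin 3,
      ((∫ s in Icc 0 τ, (r ^ 2)⁻¹ * max (1 - |s - p.1| / r ^ 2) 0 * MpsiC r (γ s) p.2 (fun v => v l * v l)) -
        (∫ s in Icc 0 τ, (r ^ 2)⁻¹ * max (1 - |s - p.1| / r ^ 2) 0 * MpsiC r (γ s) p.2 (fun v => v l)) *
        (∫ s in Icc 0 τ, (r ^ 2)⁻¹ * max (1 - |s - p.1| / r ^ 2) 0 * MpsiC r (γ s) p.2 (fun v => v l)) /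
        (∫ s in Icc 0 τ, (r ^ 2)⁻¹ * max (1 - |s - p.1| / r ^ 2) 0 * rhoC r (γ s) p.2))) / 3 :=
    (Finset.measurable_sum _ fun l _ => hC l l).div_const 3
  refine Finset.measurable_sum _ fun j _ => Finset.measurable_sum _ fun k _ => ?_
  by_cases hjk : j = k
  · simp only [hjk, if_true]
    exact ((hC k k).sub htr).abs
  · simp only [hjk, if_false, sub_zero]
    exact (hC j k).abs

/-- The windowed momentum increment `Δm(t₀, x)` is measurable in the window. [folklore] -/
theorem measurable_momIncrementW :
    Measurable fun p : ℝ × T3 => ∫ s in Icc 0 τ, (r ^ 2)⁻¹ * max (1 - |s - p.1| / r ^ 2) 0 *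
      ‖momC r (γ s) p.2 - momC r (γ p.1) p.2‖ := by
  have hG : Measurable fun q : (ℝ × T3) × ℝ => (r ^ 2)⁻¹ * max (1 - |q.2 - q.1.1| / r ^ 2) 0 *
      ‖momC r (γ q.2) q.1.2 - momC r (γ q.1.1) q.1.2‖ := (measurable_tent_pair r).mul (measurable_momC_increment hγ r)
  exact (hG.stronglyMeasurable.integral_prod_right' (ν := volume.restrict (Icc 0 τ))).measurable

/-- The windowed density increment `Δρ(t₀, x)` is measurable in the window. [folklore] -/
theorem measurable_rhoIncrementW :
    Measurable fun p : ℝ × T3 => ∫ s in Icc 0 τ, (r ^ 2)⁻¹ * max (1 - |s - p.1| / r ^ 2) 0 *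
      |rhoC r (γ s) p.2 - rhoC r (γ p.1) p.2| := by
  have hG : Measurable fun q : (ℝ × T3) × ℝ => (r ^ 2)⁻¹ * max (1 - |q.2 - q.1.1| / r ^ 2) 0 *
      |rhoC r (γ q.2) q.1.2 - rhoC r (γ q.1.1) q.1.2| := (measurable_tent_pair r).mul (measurable_rhoC_increment hγ r)
  exact (hG.stronglyMeasurable.integral_prod_right' (ν := volume.restrict (Icc 0 τ))).measurable

end Orbit

/-! ## §2 The deviator term over all windows -/

/-- `|a| = max a 0 + max (−a) 0`. [folklore] -/
theorem abs_eq_posPart_add_negPart (a : ℝ) : |a| = max a 0 + max (-a) 0 := by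
  rcases le_total 0 a with h | h
  · rw [abs_of_nonneg h, max_eq_left h, max_eq_right (by linarith), add_zero]
  · rw [abs_of_nonpos h, max_eq_right h, max_eq_left (by linarith), zero_add]

/-- **The deviator term over all windows.**  Along a measurable curve with `ke ≤ K`, for a continuous `g` with
`|g| ≤ Gb` on `[0, ∞)`, `σ ≥ 0`, `0 ≤ A`, `0 < r` and `I ⊆ [0, τ]`:
`∫⁻_I ∫⁻ₓ ofReal (|g(σ³ρ_w)| (A dev)) ≤ ofReal (A (D₊ + D₋))`. [folklore] -/
theorem lintegral_devTerm_le {γ : ℝ → Phase N} (hγ : Measurable γ) {K : ℝ} (hK : ∀ s, ke (γ s) ≤ K)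
    {r : ℝ} (hr : 0 < r) (τ : ℝ) {σ : ℝ} (hσ : 0 ≤ σ) (g : ℝ → ℝ) (hgc : Continuous g) {Gb : ℝ}
    (hGb : ∀ b, 0 ≤ b → |g b| ≤ Gb) {A : ℝ} (hA : 0 ≤ A) {I : Set ℝ} (hI : I ⊆ Icc 0 τ) :
    ∫⁻ t₀ in I, ∫⁻ x, ENNReal.ofReal (|g (σ ^ 3 * ∫ s in Icc 0 τ, (r ^ 2)⁻¹ * max (1 - |s - t₀| / r ^ 2) 0 * rhoC r (γ s) x)| *
      (A * ∑ j : Fin 3, ∑ k : Fin 3,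
      |((∫ s in Icc 0 τ, (r ^ 2)⁻¹ * max (1 - |s - t₀| / r ^ 2) 0 * MpsiC r (γ s) x (fun v => v j * v k)) -
        (∫ s in Icc 0 τ, (r ^ 2)⁻¹ * max (1 - |s - t₀| / r ^ 2) 0 * MpsiC r (γ s) x (fun v => v j)) *
        (∫ s in Icc 0 τ, (r ^ 2)⁻¹ * max (1 - |s - t₀| / r ^ 2) 0 * MpsiC r (γ s) x (fun v => v k)) /
        (∫ s in Icc 0 τ, (r ^ 2)⁻¹ * max (1 - |s - t₀| / r ^ 2) 0 * rhoC r (γ s) x)) -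
      if j = k then (∑ l, ((∫ s in Icc 0 τ, (r ^ 2)⁻¹ * max (1 - |s - t₀| / r ^ 2) 0 * MpsiC r (γ s) x (fun v => v l * v l)) -
        (∫ s in Icc 0 τ, (r ^ 2)⁻¹ * max (1 - |s - t₀| / r ^ 2) 0 * MpsiC r (γ s) x (fun v => v l)) *
        (∫ s in Icc 0 τ, (r ^ 2)⁻¹ * max (1 - |s - t₀| / r ^ 2) 0 * MpsiC r (γ s) x (fun v => v l)) /
        (∫ s in Icc 0 τ, (r ^ 2)⁻¹ * max (1 - |s - t₀| / r ^ 2) 0 * rhoC r (γ s) x))) / 3 else 0|)) ≤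
    ENNReal.ofReal (A * ((∫ t₀ in Icc 0 τ, ∫ x, max (g (σ ^ 3 * ∫ s in Icc 0 τ, (r ^ 2)⁻¹ * max (1 - |s - t₀| / r ^ 2) 0 *
        rhoC r (γ s) x)) 0 * ∑ j : Fin 3, ∑ k : Fin 3,
      |((∫ s in Icc 0 τ, (r ^ 2)⁻¹ * max (1 - |s - t₀| / r ^ 2) 0 * MpsiC r (γ s) x (fun v => v j * v k)) -
        (∫ s in Icc 0 τ, (r ^ 2)⁻¹ * max (1 - |s - t₀| / r ^ 2) 0 * MpsiC r (γ s) x (fun v => v j)) *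
        (∫ s in Icc 0 τ, (r ^ 2)⁻¹ * max (1 - |s - t₀| / r ^ 2) 0 * MpsiC r (γ s) x (fun v => v k)) /
        (∫ s in Icc 0 τ, (r ^ 2)⁻¹ * max (1 - |s - t₀| / r ^ 2) 0 * rhoC r (γ s) x)) -
      if j = k then (∑ l, ((∫ s in Icc 0 τ, (r ^ 2)⁻¹ * max (1 - |s - t₀| / r ^ 2) 0 * MpsiC r (γ s) x (fun v => v l * v l)) -
        (∫ s in Icc 0 τ, (r ^ 2)⁻¹ * max (1 - |s - t₀| / r ^ 2) 0 * MpsiC r (γ s) x (fun v => v l)) *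
        (∫ s in Icc 0 τ, (r ^ 2)⁻¹ * max (1 - |s - t₀| / r ^ 2) 0 * MpsiC r (γ s) x (fun v => v l)) /
        (∫ s in Icc 0 τ, (r ^ 2)⁻¹ * max (1 - |s - t₀| / r ^ 2) 0 * rhoC r (γ s) x))) / 3 else 0|) +
      (∫ t₀ in Icc 0 τ, ∫ x, max (-g (σ ^ 3 * ∫ s in Icc 0 τ, (r ^ 2)⁻¹ * max (1 - |s - t₀| / r ^ 2) 0 *
        rhoC r (γ s) x)) 0 * ∑ j : Fin 3, ∑ k : Fin 3,
      |((∫ s in Icc 0 τ, (r ^ 2)⁻¹ * max (1 - |s - t₀| / r ^ 2) 0 * MpsiC r (γ s) x (fun v => v j * v k)) -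
        (∫ s in Icc 0 τ, (r ^ 2)⁻¹ * max (1 - |s - t₀| / r ^ 2) 0 * MpsiC r (γ s) x (fun v => v j)) *
        (∫ s in Icc 0 τ, (r ^ 2)⁻¹ * max (1 - |s - t₀| / r ^ 2) 0 * MpsiC r (γ s) x (fun v => v k)) /
        (∫ s in Icc 0 τ, (r ^ 2)⁻¹ * max (1 - |s - t₀| / r ^ 2) 0 * rhoC r (γ s) x)) -
      if j = k then (∑ l, ((∫ s in Icc 0 τ, (r ^ 2)⁻¹ * max (1 - |s - t₀| / r ^ 2) 0 * MpsiC r (γ s) x (fun v => v l * v l)) -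
        (∫ s in Icc 0 τ, (r ^ 2)⁻¹ * max (1 - |s - t₀| / r ^ 2) 0 * MpsiC r (γ s) x (fun v => v l)) *
        (∫ s in Icc 0 τ, (r ^ 2)⁻¹ * max (1 - |s - t₀| / r ^ 2) 0 * MpsiC r (γ s) x (fun v => v l)) /
        (∫ s in Icc 0 τ, (r ^ 2)⁻¹ * max (1 - |s - t₀| / r ^ 2) 0 * rhoC r (γ s) x))) / 3 else 0|))) := by
  -- name the window density, the deviator and the two signed parts
  set ρw : ℝ × T3 → ℝ := fun p => ∫ s in Icc 0 τ, (r ^ 2)⁻¹ * max (1 - |s - p.1| / r ^ 2) 0 * rhoC r (γ s) p.2 with hρw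
  set dev : ℝ × T3 → ℝ := fun p => ∑ j : Fin 3, ∑ k : Fin 3,
      |((∫ s in Icc 0 τ, (r ^ 2)⁻¹ * max (1 - |s - p.1| / r ^ 2) 0 * MpsiC r (γ s) p.2 (fun v => v j * v k)) -
        (∫ s in Icc 0 τ, (r ^ 2)⁻¹ * max (1 - |s - p.1| / r ^ 2) 0 * MpsiC r (γ s) p.2 (fun v => v j)) *
        (∫ s in Icc 0 τ, (r ^ 2)⁻¹ * max (1 - |s - p.1| / r ^ 2) 0 * MpsiC r (γ s) p.2 (fun v => v k)) /
        (∫ s in Icc 0 τ, (r ^ 2)⁻¹ * max (1 - |s - p.1| / r ^ 2) 0 * rhoC r (γ s) p.2)) -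
      if j = k then (∑ l, ((∫ s in Icc 0 τ, (r ^ 2)⁻¹ * max (1 - |s - p.1| / r ^ 2) 0 * MpsiC r (γ s) p.2 (fun v => v l * v l)) -
        (∫ s in Icc 0 τ, (r ^ 2)⁻¹ * max (1 - |s - p.1| / r ^ 2) 0 * MpsiC r (γ s) p.2 (fun v => v l)) *
        (∫ s in Icc 0 τ, (r ^ 2)⁻¹ * max (1 - |s - p.1| / r ^ 2) 0 * MpsiC r (γ s) p.2 (fun v => v l)) /
        (∫ s in Icc 0 τ, (r ^ 2)⁻¹ * max (1 - |s - p.1| / r ^ 2) 0 * rhoC r (γ s) p.2))) / 3 else 0| with hdev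
  set Ψp : ℝ × T3 → ℝ := fun p => max (g (σ ^ 3 * ρw p)) 0 * dev p with hΨp
  set Ψm : ℝ × T3 → ℝ := fun p => max (-g (σ ^ 3 * ρw p)) 0 * dev p with hΨm
  have hGb0 : 0 ≤ Gb := (abs_nonneg _).trans (hGb 0 le_rfl)
  have hρw0 : ∀ p, 0 ≤ ρw p := fun p =>
    integral_nonneg fun s => mul_nonneg (tent_nonneg_le (by positivity) _).1 (rhoC_nonneg hr _ _)
  have hdev0 : ∀ p, 0 ≤ dev p := fun p => Finset.sum_nonneg fun j _ => Finset.sum_nonneg fun k _ => abs_nonneg _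
  have hdevB : ∀ p, dev p ≤ 144 * (3 / (Real.pi * r ^ 3) * K) := fun p => dev_le hγ hK hr p.1 τ p.2
  have hρwm : Measurable ρw := measurable_rhoW hγ r τ
  have hdevm : Measurable dev := measurable_dev hγ r τ
  have hgpm : Measurable fun p => max (g (σ ^ 3 * ρw p)) 0 := (hgc.measurable.comp (hρwm.const_mul _)).max measurable_const
  have hgmm : Measurable fun p => max (-g (σ ^ 3 * ρw p)) 0 := (hgc.measurable.comp (hρwm.const_mul _)).neg.max measurable_const
  have hΨpm : Measurable Ψp := hgpm.mul hdevm
  have hΨmm : Measurable Ψm := hgmm.mul hdevm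
  have hΨp0 : ∀ p, 0 ≤ Ψp p := fun p => mul_nonneg (le_max_right _ _) (hdev0 p)
  have hΨm0 : ∀ p, 0 ≤ Ψm p := fun p => mul_nonneg (le_max_right _ _) (hdev0 p)
  have hgp_le : ∀ p, max (g (σ ^ 3 * ρw p)) 0 ≤ Gb := fun p =>
    max_le ((le_abs_self _).trans (hGb _ (mul_nonneg (pow_nonneg hσ 3) (hρw0 p)))) hGb0
  have hgm_le : ∀ p, max (-g (σ ^ 3 * ρw p)) 0 ≤ Gb := fun p =>
    max_le ((neg_le_abs _).trans (hGb _ (mul_nonneg (pow_nonneg hσ 3) (hρw0 p)))) hGb0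
  have hΨpB : ∀ p, Ψp p ≤ Gb * (144 * (3 / (Real.pi * r ^ 3) * K)) := fun p =>
    mul_le_mul (hgp_le p) (hdevB p) (hdev0 p) hGb0
  have hΨmB : ∀ p, Ψm p ≤ Gb * (144 * (3 / (Real.pi * r ^ 3) * K)) := fun p =>
    mul_le_mul (hgm_le p) (hdevB p) (hdev0 p) hGb0
  -- split `|g| = g₊ + g₋`
  have hsplit : ∀ p : ℝ × T3, ENNReal.ofReal (|g (σ ^ 3 * ρw p)| * (A * dev p)) =
      ENNReal.ofReal A * ENNReal.ofReal (Ψp p) + ENNReal.ofReal A * ENNReal.ofReal (Ψm p) := by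
    intro p
    rw [abs_eq_posPart_add_negPart, ← mul_add, ← ENNReal.ofReal_add (hΨp0 p) (hΨm0 p), ← ENNReal.ofReal_mul hA]
    congr 1
    simp only [hΨp, hΨm]
    ring
  have hD := lintegral_lintegral_le_ofReal hΨpm hΨp0 hΨpB hI
  have hE := lintegral_lintegral_le_ofReal hΨmm hΨm0 hΨmB hI
  have hDp0 : 0 ≤ ∫ t₀ in Icc 0 τ, ∫ x, Ψp (t₀, x) := integral_nonneg fun t₀ => integral_nonneg fun x => hΨp0 _
  have hEp0 : 0 ≤ ∫ t₀ in Icc 0 τ, ∫ x, Ψm (t₀, x) := integral_nonneg fun t₀ => integral_nonneg fun x => hΨm0 _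
  change ∫⁻ t₀ in I, ∫⁻ x, ENNReal.ofReal (|g (σ ^ 3 * ρw (t₀, x))| * (A * dev (t₀, x))) ≤
    ENNReal.ofReal (A * ((∫ t₀ in Icc 0 τ, ∫ x, Ψp (t₀, x)) + ∫ t₀ in Icc 0 τ, ∫ x, Ψm (t₀, x)))
  simp_rw [hsplit]
  have hmx : ∀ t₀, Measurable fun x : T3 => ENNReal.ofReal A * ENNReal.ofReal (Ψp (t₀, x)) := fun t₀ =>
    ((Measurable.comp hΨpm (measurable_const.prodMk measurable_id) :)).ennreal_ofReal.const_mul _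
  have hmt : Measurable fun t₀ : ℝ => ∫⁻ x, ENNReal.ofReal A * ENNReal.ofReal (Ψp (t₀, x)) :=
    (hΨpm.ennreal_ofReal.const_mul _).lintegral_prod_right'
  calc ∫⁻ t₀ in I, ∫⁻ x, ENNReal.ofReal A * ENNReal.ofReal (Ψp (t₀, x)) + ENNReal.ofReal A * ENNReal.ofReal (Ψm (t₀, x))
      = ∫⁻ t₀ in I, (∫⁻ x, ENNReal.ofReal A * ENNReal.ofReal (Ψp (t₀, x))) +
          ∫⁻ x, ENNReal.ofReal A * ENNReal.ofReal (Ψm (t₀, x)) := lintegral_congr fun t₀ => lintegral_add_left (hmx t₀) _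
    _ = (∫⁻ t₀ in I, ∫⁻ x, ENNReal.ofReal A * ENNReal.ofReal (Ψp (t₀, x))) +
          ∫⁻ t₀ in I, ∫⁻ x, ENNReal.ofReal A * ENNReal.ofReal (Ψm (t₀, x)) := lintegral_add_left hmt _
    _ = ENNReal.ofReal A * (∫⁻ t₀ in I, ∫⁻ x, ENNReal.ofReal (Ψp (t₀, x))) +
          ENNReal.ofReal A * ∫⁻ t₀ in I, ∫⁻ x, ENNReal.ofReal (Ψm (t₀, x)) := by
        congr 1
        · rw [← lintegral_const_mul' _ _ ENNReal.ofReal_ne_top]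
          exact lintegral_congr fun t₀ => lintegral_const_mul' _ _ ENNReal.ofReal_ne_top
        · rw [← lintegral_const_mul' _ _ ENNReal.ofReal_ne_top]
          exact lintegral_congr fun t₀ => lintegral_const_mul' _ _ ENNReal.ofReal_ne_top
    _ ≤ ENNReal.ofReal A * ENNReal.ofReal (∫ t₀ in Icc 0 τ, ∫ x, Ψp (t₀, x)) +
          ENNReal.ofReal A * ENNReal.ofReal (∫ t₀ in Icc 0 τ, ∫ x, Ψm (t₀, x)) := by gcongr
    _ = ENNReal.ofReal (A * ((∫ t₀ in Icc 0 τ, ∫ x, Ψp (t₀, x)) + ∫ t₀ in Icc 0 τ, ∫ x, Ψm (t₀, x))) := by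
        rw [← ENNReal.ofReal_mul hA, ← ENNReal.ofReal_mul hA, ← ENNReal.ofReal_add (mul_nonneg hA hDp0) (mul_nonneg hA hEp0)]
        congr 1; ring

/-- **Registered sub-goal `stub_stressIsotropyOfWindowCovarianceJ` (helper J of
`stub_stressIsotropyOfWindowCovariance`): the signed split of a weighted absolute value**, `|a| A = a₊ A + a₋ A` — how
the deviator term of the window-to-cone step is priced by the TWO `WindowCovarianceIsotropy` functionals. [folklore] -/
theorem stub_stressIsotropyOfWindowCovarianceJ : ∀ (a A : ℝ), |a| * A = max a 0 * A + max (-a) 0 * A :=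
  fun a A => by rw [abs_eq_posPart_add_negPart, add_mul]

end Summit.AtomisticToContinuum.HydrodynamicLimit.Theorems.ParityBandClosureWindowToCone

end
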